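import Summits.HodgeConjecture.CorCM.CyclicSexticWeilLineSumTwo
import Summits.HodgeConjecture.CorCM.Census.DeligneWeilFamilyZeta7
import Summits.HodgeConjecture.CorCM.Model.WeilFaceCorners
import Summits.HodgeConjecture.CorCM.StubTree.Combinatorics
import Summits.HodgeConjecture.CorCM.Geometry.NonVacuity
import Literature.AlgebraicGeometry.Deligne1982.WeilClassesCMFamilyDivisorCriterion
import Literature.AlgebraicGeometry.HodgeTheory.AbelianVarietyHodgeFullnessHolds
import HarnessLib

/-!
# The Weil classes of a rank-four face product are EXCEPTIONAL — at every face of every CM field of degree `≥ 6`;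
# for a Galois sextic CM field they are moreover ALGEBRAIC given Markman's fourfold theorem

COR-CM (cell `pub-hodgecm2`), seat b30 gen 12 (2026-08-21); COUNT-NEUTRAL (no binder row of `HOME/BINDER-OWNERS.md`);
theorems only, no named fact, no `sorry`.

The hypothesis `W^{RK4}` of the stage-2 chain (`Universe.WeilFaceAlgebraic F f`, `CorCM/Geometry/Statements.lean`),
its real-carrier form `HodgeTheory.weilLineClasses (A_j) ι 4 ≤ algebraicClasses (⨁_j A_j) 2` (seat b07's junction
`Model.weilFaceAlgebraic_of_weilLineClasses_le`) and the conclusion `HC_CM` all speak, at a rank-four face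
`f = (Φ; π, π′)` of a CM field `K` (`Face K`, `CorCM/CM/Basic.lean`), about the `K`-Weil classes of the face product
`P(f) = A_{Φ₁} × A_{Φ₂} × A_{Φ₃} × A_{Φ₄}` (corners `Φ, Φ̄^{(π)}, Φ̄^{(π′)}, Φ^{(ππ′)}`).  This file certifies in the
kernel that these classes are never «cheap»:

* §1 (UNCONDITIONAL; every CM field `K` with `6 ≤ [K:ℚ]`, every face `f`, EVERY family of realisations `A_j` of the
  corners).  The corner family is a Deligne family `(Φ_j)_{j<4}` with constant column sums `Σ_j 1_{Φ_j} = 2`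
  (rfwf Lemma 1.2, the tree's `sumTwo_corner`) which is NEVER a union of conjugate pairs: `Φ̄` is not a corner
  (`Face.typeCount_corner_compl_eq_zero` — at an admissible embedding `ι₁ ∈ Φ` off the places `π, π′`, which exists
  exactly because `[K:ℚ] ≥ 6`, the corners `Φ̄^{(π)}, Φ̄^{(π′)}` contain `ῑ₁` and `Φ^{(ππ′)}` contains `ι₁`, while
  `Φ̄^{(π)} ≠ Φ̄ ≠ Φ̄^{(π′)}` at the places `π, π′`).  Hence, by the PROVED divisor criterion for Deligne's Weil classes
  (lit-deligne-3, `Deligne1982/WeilClassesCMFamilyDivisorCriterion`: Deligne LNM 900 I §5 (c) + Lemma 5.2 in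
  Pohlmann's coordinates; White's count, Gordon 9.2.2): `Face.exists_exceptional_biproduct_corner` — `P(f)` carries a
  rational class of Hodge type `(2,2)` OUTSIDE `D²(P(f)) ⊗ ℂ` (the span of products of two divisor classes);
  `Face.finrank_le_finrank_hodgeClassSpan_sub` — `[K:ℚ] ≤ dim_ℂ B²(P(f)) ⊗ ℂ − dim_ℂ D²(P(f)) ⊗ ℂ`;
  `Face.not_weightClasses_weilWeight_le_divisorClassesSpan` — EACH of the `[K:ℚ]` Weil lines `H⁴(P(f))_{4×{s}}`
  (which lie in `weilLineClasses`, `Deligne1982.weightClassesAlg_weilWeight_le_weilLineClasses`) is outside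
  `D² ⊗ ℂ`.  Read at the model universe's own corner realisations (`Model.cornerAV`, seat b07's
  `Model.cornerAV_isCMTypeRealisation`, with the record `h₃ := cmAbelianVarietyRealised_holds`):
  `Face.exists_exceptional_cornerAV`.  So neither `W^{RK4}` nor `HC_CM` at a face product is discharged by the
  Lefschetz `(1,1)` theorem and cup products — at ANY face (witness-of-content for the tribunal's BC5 column).
* §2 (Galois SEXTIC `K`, GIVEN Markman's fourfold theorem `Markman2025_weilClasses_algebraic_abelianFourfold`; Riemann's
  theorem and the realisation record are the tree's theorems `deligneMilne1982_Thm_6_20_full_holds`,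
  `cmAbelianVarietyRealised_holds`).  By seat b30 gen 11's T1/T2 (`CyclicSexticFaceMonomialAlgebraic`,
  `CyclicSexticWeilLineSumTwo`): `CyclicSextic.weightClasses_weilWeight_le_algebraicClasses_of_markman` (every Weil
  line of `P(f)` is algebraic AND exceptional), `CyclicSextic.exists_exceptional_algebraic_of_markman` (a rational
  `(2,2)` class on `P(f)` outside `D² ⊗ ℂ` and inside `algebraicClasses`), and the CLOSED witnesses
  `CyclicSextic.exists_dim_twelve_exceptional_algebraic_of_markman` (for EVERY Galois sextic CM field `K`: a
  `12`-dimensional product of four CM threefolds of `K` with such a class) and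
  `CyclicSextic.exists_abelianVariety_exceptional_algebraic_of_markman` (over `ℚ(ζ₇)`, lit-deligne-3's family
  `Census.DeligneWeilFamilyZeta7.Φ7` BY NAME): **Markman's theorem on abelian FOURFOLDS of Weil type yields, in the
  kernel, algebraic codimension-`2` classes on `12`-dimensional abelian varieties that are not in the span of
  products of divisor classes** — the content of the A1 rung `CyclicSexticHodgeRungOfMarkman` made visible.

## References
* [Deligne1982HodgeCycles] P. Deligne, *Hodge cycles on abelian varieties*, LNM 900 (1982), I §5 (c), Lemma 5.2.
* [Gordon1999HodgeAVSurvey] B. B. Gordon, *A survey of the Hodge conjecture for abelian varieties*, 9.2.2, §9.3.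
* [Milne1999LefschetzClasses] J. S. Milne, Duke Math. J. 96 (1999), Example 4.10 ("the Weil classes are exotic").
* [Markman2025SurveySecant] E. Markman, arXiv:2509.23403, Thm. 1.2 (the displayed hypothesis of §2).
* [Andre1992HodgeCM] Y. André, Progr. Math. 102 (1992), Théorème (pp. 4–5).
-/

noncomputable section

open CategoryTheory CategoryTheory.Limits NumberField

namespace Summit.HodgeConjecture.CorCM

open Literature.NumberTheory.ComplexMultiplication
open Literature.NumberTheory.ComplexMultiplication.CMTypeOps
open Literature.AlgebraicGeometry.Motives (AbelianVariety CMType)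
open Literature.AlgebraicGeometry.HodgeTheory
open Literature.AlgebraicGeometry.ComplexMultiplication (IsCMTypeRealisation)
open Literature.AlgebraicGeometry.VanGeemen1994 (hodgeClassSpan)
open Literature.AlgebraicGeometry.Pohlmann1968
open Literature.AlgebraicGeometry.Deligne1982
open Literature.Barriers.HodgeConjecture (divisorClassesSpan)
open Literature.NumberTheory.Automorphic.PicardCM (CMAbelianVarietyRealised)

/-! ## §1 Every face product carries exceptional Weil classes (unconditional) -/

namespace Face

section Combinatorics

variable {K : Type} [Field K]

/-- **`Σ_j 1_{Φ_j} = 2` for the corners of a face, in Deligne's counting form**: every complex embedding lies in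
exactly two of the four corners (rfwf Lemma 1.2 = the tree's `sumTwo_corner`, through
`CyclicSextic.sumTwo_iff_ncard_eq_two`). [cite: Deligne1982HodgeCycles, I §5 (c) (p. 38)] -/
theorem ncard_mem_corner_eq_two (f : Face K) (s : K →+* ℂ) :
    {j : Fin (2 * 2) | s ∈ ((f.corner : Fin (2 * 2) → CMType K) j).1}.ncard = 2 :=
  (CyclicSextic.sumTwo_iff_ncard_eq_two f.corner).1 (sumTwo_corner f) s

/-- **The conjugate type `Φ̄` is not a corner of the face `(Φ; π, π′)`** as soon as `Φ` has an admissible embedding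
`ι₁` (`ι₁ ∈ Φ` at a place other than `π, π′`): `Φ ∋ ι₁ ∉ Φ̄`; `Φ̄^{(π)} ∋ p` iff `Φ̄ ∌ p`; `Φ̄^{(π′)} ∋ p′` iff
`Φ̄ ∌ p′`; `Φ^{(ππ′)} ∋ ι₁ ∉ Φ̄`.  In Deligne's multiplicities: `d(Φ̄) = 0`. [cite: Deligne1982HodgeCycles, I Lemma 5.2 (p. 40)] -/
theorem typeCount_corner_compl_eq_zero (f : Face K) {ι₁ : K →+* ℂ} (h : f.Admissible ι₁) :
    typeCount (m := 2) f.corner (f.Φ.1)ᶜ = 0 := by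
  classical
  obtain ⟨h0, h1, h2⟩ := h
  have x : ι₁ ∉ placeSet f.p := fun hx => h1 (mk_eq_of_mem_placeSet hx)
  have y : ι₁ ∉ placeSet f.p' := fun hy => h2 (mk_eq_of_mem_placeSet hy)
  have hp : f.p ∈ placeSet f.p := Set.mem_insert _ _
  have hp' : f.p' ∈ placeSet f.p' := Set.mem_insert _ _
  unfold typeCount
  refine (Set.ncard_eq_zero (Set.toFinite _)).2 (Set.eq_empty_iff_forall_notMem.2 fun j hj => ?_)
  have hj' : ((f.corner : Fin (2 * 2) → CMType K) j).1 = (f.Φ.1)ᶜ := hj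
  fin_cases j
  · -- `Φ ≠ Φ̄`: `ι₁ ∈ Φ`
    have e : f.Φ.1 = (f.Φ.1)ᶜ := hj'
    have : ι₁ ∈ (f.Φ.1)ᶜ := e ▸ h0
    exact this h0
  · -- `Φ̄^{(π)} ≠ Φ̄`: they differ at `p`
    have e : (flip f.p (bar f.Φ)).1 = (f.Φ.1)ᶜ := hj'
    by_cases hΦ : f.p ∈ f.Φ.1
    · have : f.p ∈ (flip f.p (bar f.Φ)).1 := by
        rw [mem_flip_iff]; exact Or.inr ⟨hp, by simpa using hΦ⟩
      rw [e] at this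
      exact this hΦ
    · have : f.p ∉ (flip f.p (bar f.Φ)).1 := by
        rw [mem_flip_iff]
        rintro (⟨-, hx⟩ | ⟨-, hx⟩)
        · exact hx hp
        · exact hx (by simpa using hΦ)
      rw [e] at this
      exact this hΦ
  · -- `Φ̄^{(π′)} ≠ Φ̄`: they differ at `p′`
    have e : (flip f.p' (bar f.Φ)).1 = (f.Φ.1)ᶜ := hj'
    by_cases hΦ : f.p' ∈ f.Φ.1
    · have : f.p' ∈ (flip f.p' (bar f.Φ)).1 := by
        rw [mem_flip_iff]; exact Or.inr ⟨hp', by simpa using hΦ⟩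
      rw [e] at this
      exact this hΦ
    · have : f.p' ∉ (flip f.p' (bar f.Φ)).1 := by
        rw [mem_flip_iff]
        rintro (⟨-, hx⟩ | ⟨-, hx⟩)
        · exact hx hp'
        · exact hx (by simpa using hΦ)
      rw [e] at this
      exact this hΦ
  · -- `Φ^{(ππ′)} ≠ Φ̄`: `ι₁ ∈ Φ^{(ππ′)}`
    have e : (flip f.p' (flip f.p f.Φ)).1 = (f.Φ.1)ᶜ := hj'
    have : ι₁ ∈ (flip f.p' (flip f.p f.Φ)).1 := by
      rw [mem_flip_iff, mem_flip_iff]; exact Or.inl ⟨Or.inl ⟨h0, x⟩, y⟩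
    rw [e] at this
    exact this h0

/-- `d(Φ) ≥ 1`: `Φ = Φ₁` is a corner. -/
theorem typeCount_corner_pos (f : Face K) : 0 < typeCount (m := 2) f.corner f.Φ.1 := by
  unfold typeCount
  exact (Set.ncard_pos (Set.toFinite _)).2 ⟨0, rfl⟩

/-- **The corner family of a face with an admissible embedding is NOT conjugation-symmetric**: `d(Φ) ≠ d(Φ̄)`
(Deligne's multiplicities), i.e. it is not a union of conjugate pairs `{Ψ, Ψ̄}`.
[cite: Deligne1982HodgeCycles, I Lemma 5.2 (p. 40)] [cite: Gordon1999HodgeAVSurvey, 9.2.2] -/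
theorem exists_typeCount_corner_ne (f : Face K) {ι₁ : K →+* ℂ} (h : f.Admissible ι₁) :
    ∃ S, typeCount (m := 2) f.corner S ≠ typeCount (m := 2) f.corner Sᶜ := by
  refine ⟨f.Φ.1, ?_⟩
  rw [typeCount_corner_compl_eq_zero f h]
  exact (typeCount_corner_pos f).ne'

end Combinatorics

section Geometry

variable (K : CMField) (h6 : 6 ≤ Module.finrank ℚ K) (f : Face K)
variable {A : Fin (2 * 2) → AbelianVariety ℂ} {ι : ∀ j, 𝓞 K →+* End (A j)}
  {θ : ∀ j, (K : Type) →+* Module.End ℂ (complexBetti (A j).X 1)}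

include h6 in
/-- For `[K:ℚ] ≥ 6` every face has an admissible embedding (rfwf Lemma 2.1, the tree's
`StubTree.admissible_exists`), so its corner family is not conjugation-symmetric. -/
theorem exists_typeCount_corner_ne_of_le : ∃ S, typeCount (m := 2) f.corner S ≠ typeCount (m := 2) f.corner Sᶜ := by
  obtain ⟨ι₁, h⟩ := StubTree.admissible_exists K h6 f
  exact exists_typeCount_corner_ne f h

include h6 in
/-- **Exceptional Hodge classes on every rank-four face product.**  For a CM field `K` with `[K:ℚ] ≥ 6`, a face
`f = (Φ; π, π′)` and ANY realisations `A_j` of its corners `Φ, Φ̄^{(π)}, Φ̄^{(π′)}, Φ^{(ππ′)}`, the product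
`P(f) = A₀ × A₁ × A₂ × A₃` carries a rational class of Hodge type `(2,2)` OUTSIDE `D²(P(f)) ⊗ ℂ`, the `ℂ`-span of
products of two rational `(1,1)` classes (Deligne's Weil classes of the constant-sum, non-conjugation-symmetric
corner family). [cite: Deligne1982HodgeCycles, I §5 (c) (pp. 38–39)] [cite: Gordon1999HodgeAVSurvey, 9.2.2 and §9.3]
[cite: Milne1999LefschetzClasses, Example 4.10] -/
theorem exists_exceptional_biproduct_corner (hA : ∀ j, IsCMTypeRealisation (f.corner j) (A j) (ι j) (θ j)) :
    ∃ c : complexBetti (⨁ A).X (2 * 2), IsRationalClass c ∧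
      IsOfHodgeType (⨁ A).dim (⨁ A).X (2 * 2) 2 2 c ∧ c ∉ divisorClassesSpan (⨁ A).X (⨁ A).dim 2 :=
  exists_exceptional_of_typeCount_ne (Φ := (f.corner : Fin (2 * 2) → CMType K)) hA
    (ncard_mem_corner_eq_two f) (exists_typeCount_corner_ne_of_le K h6 f)

include h6 in
/-- **All `[K:ℚ]` Weil lines of the face product are exceptional at once**:
`[K:ℚ] ≤ dim_ℂ(B²(P(f)) ⊗ ℂ) − dim_ℂ(D²(P(f)) ⊗ ℂ)` (White's count). [cite: Gordon1999HodgeAVSurvey, 9.2.2]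
[cite: Deligne1982HodgeCycles, I §5 (c) (pp. 38–39)] -/
theorem finrank_le_finrank_hodgeClassSpan_sub (hA : ∀ j, IsCMTypeRealisation (f.corner j) (A j) (ι j) (θ j)) :
    Module.finrank ℚ K ≤
      Module.finrank ℂ ↥(hodgeClassSpan (⨁ A).dim (⨁ A).X 2) -
        Module.finrank ℂ ↥(divisorClassesSpan (⨁ A).X (⨁ A).dim 2) :=
  finrank_le_finrank_hodgeClassSpan_sub_finrank_divisorClassesSpan (Φ := (f.corner : Fin (2 * 2) → CMType K)) hA
    (by norm_num) (ncard_mem_corner_eq_two f) (exists_typeCount_corner_ne_of_le K h6 f)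

include h6 in
/-- **Each Weil line `H⁴(P(f))_{4×{s}}` of the face product is exceptional**: the weight line of the Weil weight
`{0,1,2,3} × {s}` (on which `a ∈ 𝓞_K` acts by `s(a)⁴`; it lies in the `K`-Weil-line space
`weilLineClasses A ι 4` by `Deligne1982.weightClassesAlg_weilWeight_le_weilLineClasses`) is NOT contained in
`D²(P(f)) ⊗ ℂ`, for every `s : K →+* ℂ`. [cite: Milne1999LefschetzClasses, Example 4.10]
[cite: Deligne1982HodgeCycles, I §5 (c) and Lemma 5.2] -/
theorem not_weightClasses_weilWeight_le_divisorClassesSpan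
    (hA : ∀ j, IsCMTypeRealisation (f.corner j) (A j) (ι j) (θ j)) (s : (K : Type) →+* ℂ) :
    ¬ weightClassesAlg (K := fun _ : Fin (2 * 2) => (K : Type)) A ι (2 * 2) (weilWeight 2 s) ≤
        divisorClassesSpan (⨁ A).X (⨁ A).dim 2 := by
  rw [weightClassesAlg_weilWeight_le_divisorClassesSpan_iff (Φ := (f.corner : Fin (2 * 2) → CMType K)) hA s]
  obtain ⟨S, hS⟩ := exists_typeCount_corner_ne_of_le K h6 f
  exact fun h => hS (h S)

include h6 in
/-- **At the model's own corner realisations** `A_{(K,Φ_j)} := Model.cornerAV h₃ K f.corner j` (the abelian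
varieties the stage-2 face reduction is ABOUT, `h₃ := cmAbelianVarietyRealised_holds`): the face product carries a
rational `(2,2)` class outside `D² ⊗ ℂ` — unconditionally, for every CM field `K` with `[K:ℚ] ≥ 6` and every face.
[cite: Deligne1982HodgeCycles, I §5 (c) (pp. 38–39)] [cite: Gordon1999HodgeAVSurvey, 9.2.2 and §9.3] -/
theorem exists_exceptional_cornerAV :
    ∃ c : complexBetti (⨁ (Model.cornerAV cmAbelianVarietyRealised_holds K f.corner)).X (2 * 2),
      IsRationalClass c ∧
      IsOfHodgeType (⨁ (Model.cornerAV cmAbelianVarietyRealised_holds K f.corner)).dim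
        (⨁ (Model.cornerAV cmAbelianVarietyRealised_holds K f.corner)).X (2 * 2) 2 2 c ∧
      c ∉ divisorClassesSpan (⨁ (Model.cornerAV cmAbelianVarietyRealised_holds K f.corner)).X
        (⨁ (Model.cornerAV cmAbelianVarietyRealised_holds K f.corner)).dim 2 :=
  exists_exceptional_biproduct_corner K h6 f
    (A := (Model.cornerAV cmAbelianVarietyRealised_holds K f.corner : Fin (2 * 2) → AbelianVariety ℂ))
    fun j => Model.cornerAV_isCMTypeRealisation cmAbelianVarietyRealised_holds K f.corner j

end Geometry

end Face

/-! ## §2 Galois sextic CM fields: the exceptional Weil classes of every face product are ALGEBRAIC, given Markman's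
fourfold theorem -/

namespace CyclicSextic

section Sextic

variable {K : Type} [Field K] [NumberField K] [IsCMField K] [IsGalois ℚ K]
variable {A : Fin (2 * 2) → AbelianVariety ℂ} {ι : ∀ j, 𝓞 K →+* End (A j)}
  {θ : ∀ j, K →+* Module.End ℂ (complexBetti (A j).X 1)}

/-- **Every Weil line of a sextic face product is algebraic, given Markman's fourfold theorem**: the weight line of
the Weil weight `4 × {s}` lies in `weilLineClasses A ι 4` (Deligne/Milne), which seat b30's T1
`weilLineClasses_corner_le_algebraicClasses_of_markman` places inside `algebraicClasses (P(f)) 2`.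
[cite: Markman2025SurveySecant, Thm. 1.2] [cite: Deligne1982HodgeCycles, I §5 (c) (p. 38)] -/
theorem weightClasses_weilWeight_le_algebraicClasses_of_markman
    (hW4 : Markman2025_weilClasses_algebraic_abelianFourfold) (h6 : Module.finrank ℚ K = 6) (f : Face K)
    (hA : ∀ j, IsCMTypeRealisation (f.corner j) (A j) (ι j) (θ j)) (s : K →+* ℂ) :
    weightClassesAlg (K := fun _ : Fin (2 * 2) => K) A ι (2 * 2) (weilWeight 2 s) ≤ algebraicClasses (⨁ A).X 2 :=
  (weightClassesAlg_weilWeight_le_weilLineClasses A ι s).trans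
    (weilLineClasses_corner_le_algebraicClasses_of_markman hW4 deligneMilne1982_Thm_6_20_full_holds
      cmAbelianVarietyRealised_holds h6 f hA)

/-- **… and it is exceptional**: for a Galois sextic CM field, each Weil line of each face product is a line of
ALGEBRAIC classes (given Markman) NOT contained in `D² ⊗ ℂ` (unconditionally).
[cite: Markman2025SurveySecant, Thm. 1.2] [cite: Milne1999LefschetzClasses, Example 4.10] -/
theorem weightClasses_weilWeight_le_algebraicClasses_and_not_le_divisorClassesSpan_of_markman
    (hW4 : Markman2025_weilClasses_algebraic_abelianFourfold) (h6 : Module.finrank ℚ K = 6) (f : Face K)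
    (hA : ∀ j, IsCMTypeRealisation (f.corner j) (A j) (ι j) (θ j)) (s : K →+* ℂ) :
    weightClassesAlg (K := fun _ : Fin (2 * 2) => K) A ι (2 * 2) (weilWeight 2 s) ≤ algebraicClasses (⨁ A).X 2 ∧
      ¬ weightClassesAlg (K := fun _ : Fin (2 * 2) => K) A ι (2 * 2) (weilWeight 2 s) ≤
        divisorClassesSpan (⨁ A).X (⨁ A).dim 2 :=
  ⟨weightClasses_weilWeight_le_algebraicClasses_of_markman hW4 h6 f hA s,
    Face.not_weightClasses_weilWeight_le_divisorClassesSpan ⟨K⟩ (le_of_eq h6.symm) f hA s⟩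

/-- **An exceptional ALGEBRAIC class on every sextic face product, given Markman's fourfold theorem**: a rational
class of Hodge type `(2,2)` on `P(f) = A₀ × A₁ × A₂ × A₃` that is NOT in the span of products of divisor classes and IS
in the span of algebraic-cycle classes (seat b30's T2 `mem_algebraicClasses_two_cmTypedProduct_of_markman`: every
rational `(2,2)` class on a product of realisations of CM types of `K` is algebraic, given Markman).
[cite: Markman2025SurveySecant, Thm. 1.2] [cite: Andre1992HodgeCM, Théorème (pp. 4–5)]
[cite: Deligne1982HodgeCycles, I §5 (c) (pp. 38–39)] -/
theorem exists_exceptional_algebraic_of_markman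
    (hW4 : Markman2025_weilClasses_algebraic_abelianFourfold) (h6 : Module.finrank ℚ K = 6) (f : Face K)
    (hA : ∀ j, IsCMTypeRealisation (f.corner j) (A j) (ι j) (θ j)) :
    ∃ c : complexBetti (⨁ A).X (2 * 2), IsRationalClass c ∧
      IsOfHodgeType (⨁ A).dim (⨁ A).X (2 * 2) 2 2 c ∧ c ∉ divisorClassesSpan (⨁ A).X (⨁ A).dim 2 ∧
      c ∈ algebraicClasses (⨁ A).X 2 := by
  obtain ⟨c, hcQ, hcH, hcD⟩ := Face.exists_exceptional_biproduct_corner ⟨K⟩ (le_of_eq h6.symm) f hA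
  exact ⟨c, hcQ, hcH, hcD, mem_algebraicClasses_two_cmTypedProduct_of_markman hW4
    deligneMilne1982_Thm_6_20_full_holds cmAbelianVarietyRealised_holds h6 A f.corner ι θ hA c hcQ hcH⟩

end Sextic

/-- The dimension of a product of four realisations of CM types of a sextic CM field is `12`. -/
private theorem dim_biproduct_eq_twelve {K : Type} [Field K] [NumberField K] (h6 : Module.finrank ℚ K = 6)
    {Φ : Fin (2 * 2) → CMType K} {A : Fin (2 * 2) → AbelianVariety ℂ} {ι : ∀ j, 𝓞 K →+* End (A j)}
    {θ : ∀ j, K →+* Module.End ℂ (complexBetti (A j).X 1)} (hA : ∀ j, IsCMTypeRealisation (Φ j) (A j) (ι j) (θ j)) :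
    (⨁ A).dim = 12 := by
  have hj : ∀ j, (A j).dim = 3 := fun j => by
    have h : (A j).dim = Module.finrank ℚ K / 2 := Literature.AlgebraicGeometry.Motives.schemeDim_eq_holds (hA j).1
    rw [h, h6]
  rw [AndreRiemann.dim_biproduct_fin A, Finset.sum_congr rfl fun j _ => hj j]
  decide

/-- **CLOSED WITNESS, every Galois sextic CM field.**  Given Markman's fourfold theorem: for EVERY Galois CM field
`K` of degree `6` there is a `12`-dimensional abelian variety — the product of the model's realisations of the four
corners of a rank-four face of `K` — carrying a rational `(2,2)` class that is NOT in the `ℂ`-span of products of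
divisor classes and IS in the `ℚ`-span of classes of algebraic cycles.  (Faces exist — `nonempty_face`; admissible
embeddings exist — `StubTree.admissible_exists`; realisations exist — `cmAbelianVarietyRealised_holds`.)
[cite: Markman2025SurveySecant, Thm. 1.2] [cite: Deligne1982HodgeCycles, I §5 (c) (pp. 38–39)]
[cite: Andre1992HodgeCM, Théorème (pp. 4–5)] -/
theorem exists_dim_twelve_exceptional_algebraic_of_markman
    (hW4 : Markman2025_weilClasses_algebraic_abelianFourfold) (K : CMField) [IsGalois ℚ K]
    (h6 : Module.finrank ℚ K = 6) :
    ∃ A : AbelianVariety ℂ, A.dim = 12 ∧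
      ∃ c : complexBetti A.X (2 * 2), IsRationalClass c ∧ IsOfHodgeType A.dim A.X (2 * 2) 2 2 c ∧
        c ∉ divisorClassesSpan A.X A.dim 2 ∧ c ∈ algebraicClasses A.X 2 := by
  obtain ⟨f⟩ := nonempty_face K (le_trans (by norm_num) (le_of_eq h6.symm))
  have hA := fun j => Model.cornerAV_isCMTypeRealisation cmAbelianVarietyRealised_holds K f.corner j
  exact ⟨⨁ (Model.cornerAV cmAbelianVarietyRealised_holds K f.corner : Fin (2 * 2) → AbelianVariety ℂ),
    dim_biproduct_eq_twelve h6 (Φ := (f.corner : Fin (2 * 2) → CMType K)) hA,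
    exists_exceptional_algebraic_of_markman (K := (K : Type)) hW4 h6 f hA⟩

/-- `ℚ(ζ₇)` is Galois over `ℚ`. -/
private theorem isGalois_cyclotomicField_seven' : IsGalois ℚ (CyclotomicField 7 ℚ) :=
  @IsCyclotomicExtension.isGalois {7} ℚ (CyclotomicField 7 ℚ) _ _ _
    (CyclotomicField.isCyclotomicExtension 7 ℚ)

/-- **CLOSED WITNESS over `ℚ(ζ₇)` (lit-deligne-3's family `Φ7`: residue sets `{1,2,4}, {1,5,3}, {6,2,3}, {6,5,4}`).**
Given Markman's fourfold theorem there are four CM abelian threefolds with complex multiplication by `ℚ(ζ₇)` whose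
product `B` (`dim B = 12`) carries a rational `(2,2)` class OUTSIDE `D²(B) ⊗ ℂ` and INSIDE `algebraicClasses B 2`,
with `6 ≤ dim_ℂ B²(B) ⊗ ℂ − dim_ℂ D²(B) ⊗ ℂ`: Markman's theorem on abelian fourfolds of Weil type produces algebraic,
non-divisorial codimension-`2` classes in dimension `12`. [cite: Markman2025SurveySecant, Thm. 1.2]
[cite: Deligne1982HodgeCycles, I §5 (c) (pp. 38–39)] [cite: Andre1992HodgeCM, Théorème (pp. 4–5)] -/
theorem exists_abelianVariety_exceptional_algebraic_of_markman
    (hW4 : Markman2025_weilClasses_algebraic_abelianFourfold) :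
    ∃ A : Fin (2 * 2) → AbelianVariety ℂ, (∀ j, (A j).dim = 3) ∧ (⨁ A).dim = 12 ∧
      (∃ c : complexBetti (⨁ A).X (2 * 2), IsRationalClass c ∧
        IsOfHodgeType (⨁ A).dim (⨁ A).X (2 * 2) 2 2 c ∧ c ∉ divisorClassesSpan (⨁ A).X (⨁ A).dim 2 ∧
        c ∈ algebraicClasses (⨁ A).X 2) ∧
      6 ≤ Module.finrank ℂ ↥(hodgeClassSpan (⨁ A).dim (⨁ A).X 2) -
        Module.finrank ℂ ↥(divisorClassesSpan (⨁ A).X (⨁ A).dim 2) := by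
  haveI : IsCyclotomicExtension {7} ℚ (CyclotomicField 7 ℚ) := CyclotomicField.isCyclotomicExtension 7 ℚ
  haveI : NumberField (CyclotomicField 7 ℚ) := IsCyclotomicExtension.numberField {7} ℚ _
  haveI : IsCMField (CyclotomicField 7 ℚ) :=
    IsCyclotomicExtension.Rat.isCMField (CyclotomicField 7 ℚ) (S := {7}) ⟨7, rfl, by norm_num⟩
  haveI : IsGalois ℚ (CyclotomicField 7 ℚ) := isGalois_cyclotomicField_seven'
  have h6 : Module.finrank ℚ (CyclotomicField 7 ℚ) = 6 := Census.DeligneWeilFamilyZeta7.finrank_eq_six _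
  choose A ι θ hA using fun j : Fin (2 * 2) =>
    cmAbelianVarietyRealised_holds (CyclotomicField 7 ℚ) (Census.DeligneWeilFamilyZeta7.Φ7 (CyclotomicField 7 ℚ) j)
  have hA' : ∀ j, IsCMTypeRealisation (Census.DeligneWeilFamilyZeta7.Φ7 (CyclotomicField 7 ℚ) j) (A j) (ι j) (θ j) :=
    fun j => hA j
  obtain ⟨c, hcQ, hcH, hcD⟩ := Census.DeligneWeilFamilyZeta7.exists_exceptional_Φ7 hA'
  exact ⟨A, Census.DeligneWeilFamilyZeta7.dim_eq_three hA', Census.DeligneWeilFamilyZeta7.dim_biproduct_Φ7 hA',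
    ⟨c, hcQ, hcH, hcD, mem_algebraicClasses_two_cmTypedProduct_of_markman hW4 deligneMilne1982_Thm_6_20_full_holds
      cmAbelianVarietyRealised_holds h6 A _ ι θ hA' c hcQ hcH⟩,
    Census.DeligneWeilFamilyZeta7.six_le_finrank_sub_Φ7 hA'⟩

end CyclicSextic

end Summit.HodgeConjecture.CorCM

end
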